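import Summits.BirchSwinnertonDyer.BirchSwinnertonDyer.Theorems.GenusKolyvaginAtTwoMinimalTwinBSDTwoKrizLiAnchor11a1
import HarnessLib

/-!
# Route `GenusKolyvaginAtTwo`, crux U₂ `MinimalTwinBSDTwo` (stmt-BirchSwinnertonDyer-22985), LINE 23 «twin_swap»: KRIZ–LI'S PRINTED SET 𝒩(11a1, ℚ(√−7)) IN THE KERNEL —
# Example 6.4 verbatim: «The set 𝒩 consists of square-free products of the signed primes −23, 37, −67, −71, 113, 137, −179, −191, 317, …»; the signed primes
# `37, −67, −71, 113, 137, −179, −191` are CERTIFIED members of `𝒩` (`−23` is in `…KrizLiAnchor11a1.lean`), each giving a rank-one U₂-class member `11a1^{(−7d)}`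
# (`N = 539·ℓ²`) with `BSD₂` from PRINT + MODULARITY alone

Seat `bsd-line-gk2-p2` g35 (PROVER 2/3, cell `bsd-f1-sign2`; LINE 23 holder), `--supports stmt-BirchSwinnertonDyer-22985` (helper; closes nothing).
KERNEL THEOREMS ONLY (0 `def`, 0 `sorry`); standard axioms.  HONEST FRAMING (D-0014/D-0036): a VERBATIM CHECK of print against the kernel — for each signed
prime `d ∈ {37, −67, −71, 113, 137, −179, −191}` of Kriz–Li's Example 6.4: the certified point count `#Ẽ(𝔽_ℓ)` (`35, 75, 75, 105, 145, 195, 175`), `a_ℓ` odd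
(`3, −7, −3, 9, −7, −15, 17`: `Frob_ℓ` of order `3` on `E[2]`), `(−7/ℓ) = 1`, `d ≡ 1 (mod 4)`, hence `d ∈ 𝒩(11a1, K)` (`inN_<d>_11A1`), and `χ_d(−11) = 1`
(automatic since `Δ(11a1) < 0`, Example 6.4 (2)); then `printFamily11A1_krizLi_witness<−7d>` = the road's `printFamily11A1_krizLi_rankOneCompanions` at that `d`:
the RANK-ONE members `11a1^{(−259)}, 11a1^{(469)}, 11a1^{(497)}, 11a1^{(−791)}, 11a1^{(−959)}, 11a1^{(1253)}, 11a1^{(1337)}` (conductors `539·ℓ²` from `737891` to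
`19663259`, all far outside Creutz–Miller's range) satisfy `r_an = 1 ∧ ¬CM ∧ BSDp · 2` modulo PRINT (Kriz–Li Thm 5.1 (2)/4.3, the Table-2 row, Creutz–Miller at
`11` and `539`) + MODULARITY (the tree's `r_an(11a1) = 0`).  The printed list and the kernel AGREE on all eight signed primes up to `191`.  **BSD is NOT proved by
any of this; U₂ is NOT proved; no item is closed.**

References: [KrizLi2019] §6 Example 6.4, Def 4.1, Thm 4.3 + Cor., Thm 5.1 (2) (arXiv:1606.03172v3 Congruence.tex ll. 1024–1034); [CreutzMiller2012] Thm 1.1;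
[CremonaAlgorithms1997] Table 1 (11A1); [SilvermanAEC2009] V.2.
-/

set_option autoImplicit false
-- the Theorems namespace of this sub repeats the summit name by design (D-0017 nested layout)
set_option linter.dupNamespace false

noncomputable section

open scoped Classical

open WeierstrassCurve NumberField Literature.NumberTheory.EllipticCurves
  Literature.NumberTheory.EllipticCurves.ModularForms
  Literature.NumberTheory.EllipticCurves.Rank1Residual
  Literature.NumberTheory.EllipticCurves.Rank1Residual.Typed
  Literature.NumberTheory.EllipticCurves.X1Eleven
  Literature.NumberTheory.EllipticCurves.BurungaleSkinner2023
  Summit.BirchSwinnertonDyer.Rank1Residual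
  Summit.BirchSwinnertonDyer.Rank1Residual.P2
  Summit.BirchSwinnertonDyer.BirchSwinnertonDyer.Theorems.AddPotGoodPrint
  Summit.BirchSwinnertonDyer.BirchSwinnertonDyer.Theorems.GenusExact.TwinSwap.KrizLiAnchorWall

namespace Summit.BirchSwinnertonDyer.BirchSwinnertonDyer.Theorems.GenusExact.TwinSwap.KrizLiAnchor11a1

/-! ### `ℓ = 37`: `#Ẽ(𝔽_37) = 35`, `a_37 = 3` odd; the signed prime `37 ∈ 𝒩(11a1, ℚ(√−7))` -/

/-- **`#Ẽ(𝔽_37) = 35` for `11a1`** (certified count), so `a_37 = 3`. [cite: KrizLi2019, §6 Example 6.4 (the signed prime 37 of 𝒩)] [cite: SilvermanAEC2009, V.2] -/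
theorem reductionPointCount_37_11A1 :
    haveI := isGloballyMinimal_curve11A1
    curve11A1.reductionPointCount 37 = 35 := by
  haveI : Fact (Nat.Prime 37) := ⟨by norm_num⟩
  haveI := isGloballyMinimal_curve11A1
  exact Supersingular.reductionPointCount_eq_of_intModel_countPoints intModel_11A1 37 (by norm_num) (by decide +kernel)
    (by decide +kernel)

/-- **`a_37(11a1) = 3` is odd** (`Frob_37` of order `3` on `E[2]`). [cite: KrizLi2019, Def. 4.1 and §6 Example 6.4] -/
theorem odd_frobeniusTrace_37_11A1 :
    haveI := isGloballyMinimal_curve11A1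
    Odd (curve11A1.frobeniusTrace 37) := by
  haveI := isGloballyMinimal_curve11A1
  rw [Uniform.U2.odd_frobeniusTrace_iff_odd_reductionPointCount _ (by norm_num : Nat.Prime 37) (by norm_num),
    reductionPointCount_37_11A1]
  decide

/-- **`37 ∈ 𝒩(11a1, K)`** (`d_K = −7`), as printed in Kriz–Li's Example 6.4: `37 ≡ 1 (mod 4)`, `|37| = 37` prime `∉ {2, 11}`, `(−7/37) = 1`, `a_37` odd.
[cite: KrizLi2019, §6 Example 6.4 ("𝒩 consists of square-free products of the signed primes −23, 37, −67, −71, 113, 137, −179, −191, …")] -/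
theorem inN_37_11A1 {K : Type} [Field K] [NumberField K] (h2 : Module.finrank ℚ K = 2) (hdK : NumberField.discr K = -7) :
    haveI := isGloballyMinimal_curve11A1
    KrizLi2019.InN curve11A1 K (37) := by
  haveI := isGloballyMinimal_curve11A1
  have hw : Nat.Prime 37 := by norm_num
  have hna : (37 : ℤ).natAbs = 37 := rfl
  refine ⟨by decide, by rw [hna]; exact hw.squarefree, fun ℓ hℓ hℓd => ?_⟩
  rw [hna] at hℓd
  obtain rfl := (Nat.prime_dvd_prime_iff_eq hℓ hw).mp hℓd
  exact inS_11A1 h2 hdK hw (by norm_num) (by norm_num) (by norm_num) odd_frobeniusTrace_37_11A1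

/-- **`χ_{37}(−11) = 1`** (automatic here: `Δ(11a1) < 0`, Kriz–Li Cor. to Thm 4.3), read with `N = 11` exact. [cite: KrizLi2019, Thm. 5.1 (2) and §6 Example 6.4 (2)] -/
theorem sign_37_11A1 :
    Int.sign (37) * jacobiSym (curve11A1.conductorNorm ℤ) (37 : ℤ).natAbs = 1 := by
  rw [Curve11a.conductorNorm_curve11A1, show (37 : ℤ).natAbs = 37 from rfl]; norm_num

/-- **The rank-one member `11a1^{(-259)}`** (`-259 = (−7)·(37)`, `N = 539·37² = 737891`): `r_an = 1 ∧ ¬CM ∧ BSD(·, 2)` at every global minimal model, from PRINT +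
MODULARITY alone — a U₂-class curve of Kriz–Li's printed packet. BSD is not proved by any of this. [cite: KrizLi2019, §6 Example 6.4 (4) and Thm. 5.1 (2)] [cite: CreutzMiller2012, Thm. 1.1] -/
theorem printFamily11A1_krizLi_witnessneg259 (hKL : KrizLi2019.thm112_bsdTwo_twist) (h33 : KrizLi2019.thm33_rank_twist)
    (htab : KrizLi2019.table2_row11a1) (hS31 : bsdTriple_of_analyticRank_le_one_of_conductor_lt) (hmod : exists_isNewformOf)
    (K : Type) [Field K] [NumberField K] (hK : IsImaginaryQuadratic K) (hdK : NumberField.discr K = -7)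
    (W₂ : WeierstrassCurve ℚ) [W₂.IsElliptic] [W₂.IsGloballyMinimal]
    (hW₂ : ∃ C : VariableChange ℚ, C • curve11A1.quadraticTwist ((-259 : ℤ) : ℚ) = W₂) :
    W₂.analyticRank = 1 ∧ ¬ W₂.HasCM ∧ BSDp W₂ 2 :=
  printFamily11A1_krizLi_rankOneCompanions hKL h33 htab hS31 hmod K hK hdK (inN_37_11A1 hK.1 hdK) sign_37_11A1 W₂
    (by rw [show ((-7 * 37 : ℤ) : ℚ) = ((-259 : ℤ) : ℚ) by norm_num]; exact hW₂)

/-! ### `ℓ = 67`: `#Ẽ(𝔽_67) = 75`, `a_67 = -7` odd; the signed prime `-67 ∈ 𝒩(11a1, ℚ(√−7))` -/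

/-- **`#Ẽ(𝔽_67) = 75` for `11a1`** (certified count), so `a_67 = -7`. [cite: KrizLi2019, §6 Example 6.4 (the signed prime -67 of 𝒩)] [cite: SilvermanAEC2009, V.2] -/
theorem reductionPointCount_67_11A1 :
    haveI := isGloballyMinimal_curve11A1
    curve11A1.reductionPointCount 67 = 75 := by
  haveI : Fact (Nat.Prime 67) := ⟨by norm_num⟩
  haveI := isGloballyMinimal_curve11A1
  exact Supersingular.reductionPointCount_eq_of_intModel_countPoints intModel_11A1 67 (by norm_num) (by decide +kernel)
    (by decide +kernel)

/-- **`a_67(11a1) = -7` is odd** (`Frob_67` of order `3` on `E[2]`). [cite: KrizLi2019, Def. 4.1 and §6 Example 6.4] -/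
theorem odd_frobeniusTrace_67_11A1 :
    haveI := isGloballyMinimal_curve11A1
    Odd (curve11A1.frobeniusTrace 67) := by
  haveI := isGloballyMinimal_curve11A1
  rw [Uniform.U2.odd_frobeniusTrace_iff_odd_reductionPointCount _ (by norm_num : Nat.Prime 67) (by norm_num),
    reductionPointCount_67_11A1]
  decide

/-- **`-67 ∈ 𝒩(11a1, K)`** (`d_K = −7`), as printed in Kriz–Li's Example 6.4: `-67 ≡ 1 (mod 4)`, `|-67| = 67` prime `∉ {2, 11}`, `(−7/67) = 1`, `a_67` odd.
[cite: KrizLi2019, §6 Example 6.4 ("𝒩 consists of square-free products of the signed primes −23, 37, −67, −71, 113, 137, −179, −191, …")] -/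
theorem inN_neg67_11A1 {K : Type} [Field K] [NumberField K] (h2 : Module.finrank ℚ K = 2) (hdK : NumberField.discr K = -7) :
    haveI := isGloballyMinimal_curve11A1
    KrizLi2019.InN curve11A1 K (-67) := by
  haveI := isGloballyMinimal_curve11A1
  have hw : Nat.Prime 67 := by norm_num
  have hna : (-67 : ℤ).natAbs = 67 := rfl
  refine ⟨by decide, by rw [hna]; exact hw.squarefree, fun ℓ hℓ hℓd => ?_⟩
  rw [hna] at hℓd
  obtain rfl := (Nat.prime_dvd_prime_iff_eq hℓ hw).mp hℓd
  exact inS_11A1 h2 hdK hw (by norm_num) (by norm_num) (by norm_num) odd_frobeniusTrace_67_11A1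

/-- **`χ_{-67}(−11) = 1`** (automatic here: `Δ(11a1) < 0`, Kriz–Li Cor. to Thm 4.3), read with `N = 11` exact. [cite: KrizLi2019, Thm. 5.1 (2) and §6 Example 6.4 (2)] -/
theorem sign_neg67_11A1 :
    Int.sign (-67) * jacobiSym (curve11A1.conductorNorm ℤ) (-67 : ℤ).natAbs = 1 := by
  rw [Curve11a.conductorNorm_curve11A1, show (-67 : ℤ).natAbs = 67 from rfl]; norm_num

/-- **The rank-one member `11a1^{(469)}`** (`469 = (−7)·(-67)`, `N = 539·67² = 2419571`): `r_an = 1 ∧ ¬CM ∧ BSD(·, 2)` at every global minimal model, from PRINT +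
MODULARITY alone — a U₂-class curve of Kriz–Li's printed packet. BSD is not proved by any of this. [cite: KrizLi2019, §6 Example 6.4 (4) and Thm. 5.1 (2)] [cite: CreutzMiller2012, Thm. 1.1] -/
theorem printFamily11A1_krizLi_witness469 (hKL : KrizLi2019.thm112_bsdTwo_twist) (h33 : KrizLi2019.thm33_rank_twist)
    (htab : KrizLi2019.table2_row11a1) (hS31 : bsdTriple_of_analyticRank_le_one_of_conductor_lt) (hmod : exists_isNewformOf)
    (K : Type) [Field K] [NumberField K] (hK : IsImaginaryQuadratic K) (hdK : NumberField.discr K = -7)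
    (W₂ : WeierstrassCurve ℚ) [W₂.IsElliptic] [W₂.IsGloballyMinimal]
    (hW₂ : ∃ C : VariableChange ℚ, C • curve11A1.quadraticTwist ((469 : ℤ) : ℚ) = W₂) :
    W₂.analyticRank = 1 ∧ ¬ W₂.HasCM ∧ BSDp W₂ 2 :=
  printFamily11A1_krizLi_rankOneCompanions hKL h33 htab hS31 hmod K hK hdK (inN_neg67_11A1 hK.1 hdK) sign_neg67_11A1 W₂
    (by rw [show ((-7 * (-67) : ℤ) : ℚ) = ((469 : ℤ) : ℚ) by norm_num]; exact hW₂)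

/-! ### `ℓ = 71`: `#Ẽ(𝔽_71) = 75`, `a_71 = -3` odd; the signed prime `-71 ∈ 𝒩(11a1, ℚ(√−7))` -/

/-- **`#Ẽ(𝔽_71) = 75` for `11a1`** (certified count), so `a_71 = -3`. [cite: KrizLi2019, §6 Example 6.4 (the signed prime -71 of 𝒩)] [cite: SilvermanAEC2009, V.2] -/
theorem reductionPointCount_71_11A1 :
    haveI := isGloballyMinimal_curve11A1
    curve11A1.reductionPointCount 71 = 75 := by
  haveI : Fact (Nat.Prime 71) := ⟨by norm_num⟩
  haveI := isGloballyMinimal_curve11A1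
  exact Supersingular.reductionPointCount_eq_of_intModel_countPoints intModel_11A1 71 (by norm_num) (by decide +kernel)
    (by decide +kernel)

/-- **`a_71(11a1) = -3` is odd** (`Frob_71` of order `3` on `E[2]`). [cite: KrizLi2019, Def. 4.1 and §6 Example 6.4] -/
theorem odd_frobeniusTrace_71_11A1 :
    haveI := isGloballyMinimal_curve11A1
    Odd (curve11A1.frobeniusTrace 71) := by
  haveI := isGloballyMinimal_curve11A1
  rw [Uniform.U2.odd_frobeniusTrace_iff_odd_reductionPointCount _ (by norm_num : Nat.Prime 71) (by norm_num),
    reductionPointCount_71_11A1]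
  decide

/-- **`-71 ∈ 𝒩(11a1, K)`** (`d_K = −7`), as printed in Kriz–Li's Example 6.4: `-71 ≡ 1 (mod 4)`, `|-71| = 71` prime `∉ {2, 11}`, `(−7/71) = 1`, `a_71` odd.
[cite: KrizLi2019, §6 Example 6.4 ("𝒩 consists of square-free products of the signed primes −23, 37, −67, −71, 113, 137, −179, −191, …")] -/
theorem inN_neg71_11A1 {K : Type} [Field K] [NumberField K] (h2 : Module.finrank ℚ K = 2) (hdK : NumberField.discr K = -7) :
    haveI := isGloballyMinimal_curve11A1
    KrizLi2019.InN curve11A1 K (-71) := by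
  haveI := isGloballyMinimal_curve11A1
  have hw : Nat.Prime 71 := by norm_num
  have hna : (-71 : ℤ).natAbs = 71 := rfl
  refine ⟨by decide, by rw [hna]; exact hw.squarefree, fun ℓ hℓ hℓd => ?_⟩
  rw [hna] at hℓd
  obtain rfl := (Nat.prime_dvd_prime_iff_eq hℓ hw).mp hℓd
  exact inS_11A1 h2 hdK hw (by norm_num) (by norm_num) (by norm_num) odd_frobeniusTrace_71_11A1

/-- **`χ_{-71}(−11) = 1`** (automatic here: `Δ(11a1) < 0`, Kriz–Li Cor. to Thm 4.3), read with `N = 11` exact. [cite: KrizLi2019, Thm. 5.1 (2) and §6 Example 6.4 (2)] -/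
theorem sign_neg71_11A1 :
    Int.sign (-71) * jacobiSym (curve11A1.conductorNorm ℤ) (-71 : ℤ).natAbs = 1 := by
  rw [Curve11a.conductorNorm_curve11A1, show (-71 : ℤ).natAbs = 71 from rfl]; norm_num

/-- **The rank-one member `11a1^{(497)}`** (`497 = (−7)·(-71)`, `N = 539·71² = 2717099`): `r_an = 1 ∧ ¬CM ∧ BSD(·, 2)` at every global minimal model, from PRINT +
MODULARITY alone — a U₂-class curve of Kriz–Li's printed packet. BSD is not proved by any of this. [cite: KrizLi2019, §6 Example 6.4 (4) and Thm. 5.1 (2)] [cite: CreutzMiller2012, Thm. 1.1] -/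
theorem printFamily11A1_krizLi_witness497 (hKL : KrizLi2019.thm112_bsdTwo_twist) (h33 : KrizLi2019.thm33_rank_twist)
    (htab : KrizLi2019.table2_row11a1) (hS31 : bsdTriple_of_analyticRank_le_one_of_conductor_lt) (hmod : exists_isNewformOf)
    (K : Type) [Field K] [NumberField K] (hK : IsImaginaryQuadratic K) (hdK : NumberField.discr K = -7)
    (W₂ : WeierstrassCurve ℚ) [W₂.IsElliptic] [W₂.IsGloballyMinimal]
    (hW₂ : ∃ C : VariableChange ℚ, C • curve11A1.quadraticTwist ((497 : ℤ) : ℚ) = W₂) :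
    W₂.analyticRank = 1 ∧ ¬ W₂.HasCM ∧ BSDp W₂ 2 :=
  printFamily11A1_krizLi_rankOneCompanions hKL h33 htab hS31 hmod K hK hdK (inN_neg71_11A1 hK.1 hdK) sign_neg71_11A1 W₂
    (by rw [show ((-7 * (-71) : ℤ) : ℚ) = ((497 : ℤ) : ℚ) by norm_num]; exact hW₂)

/-! ### `ℓ = 113`: `#Ẽ(𝔽_113) = 105`, `a_113 = 9` odd; the signed prime `113 ∈ 𝒩(11a1, ℚ(√−7))` -/

/-- **`#Ẽ(𝔽_113) = 105` for `11a1`** (certified count), so `a_113 = 9`. [cite: KrizLi2019, §6 Example 6.4 (the signed prime 113 of 𝒩)] [cite: SilvermanAEC2009, V.2] -/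
theorem reductionPointCount_113_11A1 :
    haveI := isGloballyMinimal_curve11A1
    curve11A1.reductionPointCount 113 = 105 := by
  haveI : Fact (Nat.Prime 113) := ⟨by norm_num⟩
  haveI := isGloballyMinimal_curve11A1
  exact Supersingular.reductionPointCount_eq_of_intModel_countPoints intModel_11A1 113 (by norm_num) (by decide +kernel)
    (by decide +kernel)

/-- **`a_113(11a1) = 9` is odd** (`Frob_113` of order `3` on `E[2]`). [cite: KrizLi2019, Def. 4.1 and §6 Example 6.4] -/
theorem odd_frobeniusTrace_113_11A1 :
    haveI := isGloballyMinimal_curve11A1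
    Odd (curve11A1.frobeniusTrace 113) := by
  haveI := isGloballyMinimal_curve11A1
  rw [Uniform.U2.odd_frobeniusTrace_iff_odd_reductionPointCount _ (by norm_num : Nat.Prime 113) (by norm_num),
    reductionPointCount_113_11A1]
  decide

/-- **`113 ∈ 𝒩(11a1, K)`** (`d_K = −7`), as printed in Kriz–Li's Example 6.4: `113 ≡ 1 (mod 4)`, `|113| = 113` prime `∉ {2, 11}`, `(−7/113) = 1`, `a_113` odd.
[cite: KrizLi2019, §6 Example 6.4 ("𝒩 consists of square-free products of the signed primes −23, 37, −67, −71, 113, 137, −179, −191, …")] -/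
theorem inN_113_11A1 {K : Type} [Field K] [NumberField K] (h2 : Module.finrank ℚ K = 2) (hdK : NumberField.discr K = -7) :
    haveI := isGloballyMinimal_curve11A1
    KrizLi2019.InN curve11A1 K (113) := by
  haveI := isGloballyMinimal_curve11A1
  have hw : Nat.Prime 113 := by norm_num
  have hna : (113 : ℤ).natAbs = 113 := rfl
  refine ⟨by decide, by rw [hna]; exact hw.squarefree, fun ℓ hℓ hℓd => ?_⟩
  rw [hna] at hℓd
  obtain rfl := (Nat.prime_dvd_prime_iff_eq hℓ hw).mp hℓd
  exact inS_11A1 h2 hdK hw (by norm_num) (by norm_num) (by norm_num) odd_frobeniusTrace_113_11A1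

/-- **`χ_{113}(−11) = 1`** (automatic here: `Δ(11a1) < 0`, Kriz–Li Cor. to Thm 4.3), read with `N = 11` exact. [cite: KrizLi2019, Thm. 5.1 (2) and §6 Example 6.4 (2)] -/
theorem sign_113_11A1 :
    Int.sign (113) * jacobiSym (curve11A1.conductorNorm ℤ) (113 : ℤ).natAbs = 1 := by
  rw [Curve11a.conductorNorm_curve11A1, show (113 : ℤ).natAbs = 113 from rfl]; norm_num

/-- **The rank-one member `11a1^{(-791)}`** (`-791 = (−7)·(113)`, `N = 539·113² = 6882491`): `r_an = 1 ∧ ¬CM ∧ BSD(·, 2)` at every global minimal model, from PRINT +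
MODULARITY alone — a U₂-class curve of Kriz–Li's printed packet. BSD is not proved by any of this. [cite: KrizLi2019, §6 Example 6.4 (4) and Thm. 5.1 (2)] [cite: CreutzMiller2012, Thm. 1.1] -/
theorem printFamily11A1_krizLi_witnessneg791 (hKL : KrizLi2019.thm112_bsdTwo_twist) (h33 : KrizLi2019.thm33_rank_twist)
    (htab : KrizLi2019.table2_row11a1) (hS31 : bsdTriple_of_analyticRank_le_one_of_conductor_lt) (hmod : exists_isNewformOf)
    (K : Type) [Field K] [NumberField K] (hK : IsImaginaryQuadratic K) (hdK : NumberField.discr K = -7)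
    (W₂ : WeierstrassCurve ℚ) [W₂.IsElliptic] [W₂.IsGloballyMinimal]
    (hW₂ : ∃ C : VariableChange ℚ, C • curve11A1.quadraticTwist ((-791 : ℤ) : ℚ) = W₂) :
    W₂.analyticRank = 1 ∧ ¬ W₂.HasCM ∧ BSDp W₂ 2 :=
  printFamily11A1_krizLi_rankOneCompanions hKL h33 htab hS31 hmod K hK hdK (inN_113_11A1 hK.1 hdK) sign_113_11A1 W₂
    (by rw [show ((-7 * 113 : ℤ) : ℚ) = ((-791 : ℤ) : ℚ) by norm_num]; exact hW₂)

/-! ### `ℓ = 137`: `#Ẽ(𝔽_137) = 145`, `a_137 = -7` odd; the signed prime `137 ∈ 𝒩(11a1, ℚ(√−7))` -/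

/-- **`#Ẽ(𝔽_137) = 145` for `11a1`** (certified count), so `a_137 = -7`. [cite: KrizLi2019, §6 Example 6.4 (the signed prime 137 of 𝒩)] [cite: SilvermanAEC2009, V.2] -/
theorem reductionPointCount_137_11A1 :
    haveI := isGloballyMinimal_curve11A1
    curve11A1.reductionPointCount 137 = 145 := by
  haveI : Fact (Nat.Prime 137) := ⟨by norm_num⟩
  haveI := isGloballyMinimal_curve11A1
  exact Supersingular.reductionPointCount_eq_of_intModel_countPoints intModel_11A1 137 (by norm_num) (by decide +kernel)
    (by decide +kernel)

/-- **`a_137(11a1) = -7` is odd** (`Frob_137` of order `3` on `E[2]`). [cite: KrizLi2019, Def. 4.1 and §6 Example 6.4] -/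
theorem odd_frobeniusTrace_137_11A1 :
    haveI := isGloballyMinimal_curve11A1
    Odd (curve11A1.frobeniusTrace 137) := by
  haveI := isGloballyMinimal_curve11A1
  rw [Uniform.U2.odd_frobeniusTrace_iff_odd_reductionPointCount _ (by norm_num : Nat.Prime 137) (by norm_num),
    reductionPointCount_137_11A1]
  decide

/-- **`137 ∈ 𝒩(11a1, K)`** (`d_K = −7`), as printed in Kriz–Li's Example 6.4: `137 ≡ 1 (mod 4)`, `|137| = 137` prime `∉ {2, 11}`, `(−7/137) = 1`, `a_137` odd.
[cite: KrizLi2019, §6 Example 6.4 ("𝒩 consists of square-free products of the signed primes −23, 37, −67, −71, 113, 137, −179, −191, …")] -/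
theorem inN_137_11A1 {K : Type} [Field K] [NumberField K] (h2 : Module.finrank ℚ K = 2) (hdK : NumberField.discr K = -7) :
    haveI := isGloballyMinimal_curve11A1
    KrizLi2019.InN curve11A1 K (137) := by
  haveI := isGloballyMinimal_curve11A1
  have hw : Nat.Prime 137 := by norm_num
  have hna : (137 : ℤ).natAbs = 137 := rfl
  refine ⟨by decide, by rw [hna]; exact hw.squarefree, fun ℓ hℓ hℓd => ?_⟩
  rw [hna] at hℓd
  obtain rfl := (Nat.prime_dvd_prime_iff_eq hℓ hw).mp hℓd
  exact inS_11A1 h2 hdK hw (by norm_num) (by norm_num) (by norm_num) odd_frobeniusTrace_137_11A1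

/-- **`χ_{137}(−11) = 1`** (automatic here: `Δ(11a1) < 0`, Kriz–Li Cor. to Thm 4.3), read with `N = 11` exact. [cite: KrizLi2019, Thm. 5.1 (2) and §6 Example 6.4 (2)] -/
theorem sign_137_11A1 :
    Int.sign (137) * jacobiSym (curve11A1.conductorNorm ℤ) (137 : ℤ).natAbs = 1 := by
  rw [Curve11a.conductorNorm_curve11A1, show (137 : ℤ).natAbs = 137 from rfl]; norm_num

/-- **The rank-one member `11a1^{(-959)}`** (`-959 = (−7)·(137)`, `N = 539·137² = 10116491`): `r_an = 1 ∧ ¬CM ∧ BSD(·, 2)` at every global minimal model, from PRINT +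
MODULARITY alone — a U₂-class curve of Kriz–Li's printed packet. BSD is not proved by any of this. [cite: KrizLi2019, §6 Example 6.4 (4) and Thm. 5.1 (2)] [cite: CreutzMiller2012, Thm. 1.1] -/
theorem printFamily11A1_krizLi_witnessneg959 (hKL : KrizLi2019.thm112_bsdTwo_twist) (h33 : KrizLi2019.thm33_rank_twist)
    (htab : KrizLi2019.table2_row11a1) (hS31 : bsdTriple_of_analyticRank_le_one_of_conductor_lt) (hmod : exists_isNewformOf)
    (K : Type) [Field K] [NumberField K] (hK : IsImaginaryQuadratic K) (hdK : NumberField.discr K = -7)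
    (W₂ : WeierstrassCurve ℚ) [W₂.IsElliptic] [W₂.IsGloballyMinimal]
    (hW₂ : ∃ C : VariableChange ℚ, C • curve11A1.quadraticTwist ((-959 : ℤ) : ℚ) = W₂) :
    W₂.analyticRank = 1 ∧ ¬ W₂.HasCM ∧ BSDp W₂ 2 :=
  printFamily11A1_krizLi_rankOneCompanions hKL h33 htab hS31 hmod K hK hdK (inN_137_11A1 hK.1 hdK) sign_137_11A1 W₂
    (by rw [show ((-7 * 137 : ℤ) : ℚ) = ((-959 : ℤ) : ℚ) by norm_num]; exact hW₂)

/-! ### `ℓ = 179`: `#Ẽ(𝔽_179) = 195`, `a_179 = -15` odd; the signed prime `-179 ∈ 𝒩(11a1, ℚ(√−7))` -/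

/-- **`#Ẽ(𝔽_179) = 195` for `11a1`** (certified count), so `a_179 = -15`. [cite: KrizLi2019, §6 Example 6.4 (the signed prime -179 of 𝒩)] [cite: SilvermanAEC2009, V.2] -/
theorem reductionPointCount_179_11A1 :
    haveI := isGloballyMinimal_curve11A1
    curve11A1.reductionPointCount 179 = 195 := by
  haveI : Fact (Nat.Prime 179) := ⟨by norm_num⟩
  haveI := isGloballyMinimal_curve11A1
  exact Supersingular.reductionPointCount_eq_of_intModel_countPoints intModel_11A1 179 (by norm_num) (by decide +kernel)
    (by decide +kernel)

/-- **`a_179(11a1) = -15` is odd** (`Frob_179` of order `3` on `E[2]`). [cite: KrizLi2019, Def. 4.1 and §6 Example 6.4] -/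
theorem odd_frobeniusTrace_179_11A1 :
    haveI := isGloballyMinimal_curve11A1
    Odd (curve11A1.frobeniusTrace 179) := by
  haveI := isGloballyMinimal_curve11A1
  rw [Uniform.U2.odd_frobeniusTrace_iff_odd_reductionPointCount _ (by norm_num : Nat.Prime 179) (by norm_num),
    reductionPointCount_179_11A1]
  decide

/-- **`-179 ∈ 𝒩(11a1, K)`** (`d_K = −7`), as printed in Kriz–Li's Example 6.4: `-179 ≡ 1 (mod 4)`, `|-179| = 179` prime `∉ {2, 11}`, `(−7/179) = 1`, `a_179` odd.
[cite: KrizLi2019, §6 Example 6.4 ("𝒩 consists of square-free products of the signed primes −23, 37, −67, −71, 113, 137, −179, −191, …")] -/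
theorem inN_neg179_11A1 {K : Type} [Field K] [NumberField K] (h2 : Module.finrank ℚ K = 2) (hdK : NumberField.discr K = -7) :
    haveI := isGloballyMinimal_curve11A1
    KrizLi2019.InN curve11A1 K (-179) := by
  haveI := isGloballyMinimal_curve11A1
  have hw : Nat.Prime 179 := by norm_num
  have hna : (-179 : ℤ).natAbs = 179 := rfl
  refine ⟨by decide, by rw [hna]; exact hw.squarefree, fun ℓ hℓ hℓd => ?_⟩
  rw [hna] at hℓd
  obtain rfl := (Nat.prime_dvd_prime_iff_eq hℓ hw).mp hℓd
  exact inS_11A1 h2 hdK hw (by norm_num) (by norm_num) (by norm_num) odd_frobeniusTrace_179_11A1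

/-- **`χ_{-179}(−11) = 1`** (automatic here: `Δ(11a1) < 0`, Kriz–Li Cor. to Thm 4.3), read with `N = 11` exact. [cite: KrizLi2019, Thm. 5.1 (2) and §6 Example 6.4 (2)] -/
theorem sign_neg179_11A1 :
    Int.sign (-179) * jacobiSym (curve11A1.conductorNorm ℤ) (-179 : ℤ).natAbs = 1 := by
  rw [Curve11a.conductorNorm_curve11A1, show (-179 : ℤ).natAbs = 179 from rfl]; norm_num

/-- **The rank-one member `11a1^{(1253)}`** (`1253 = (−7)·(-179)`, `N = 539·179² = 17270099`): `r_an = 1 ∧ ¬CM ∧ BSD(·, 2)` at every global minimal model, from PRINT +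
MODULARITY alone — a U₂-class curve of Kriz–Li's printed packet. BSD is not proved by any of this. [cite: KrizLi2019, §6 Example 6.4 (4) and Thm. 5.1 (2)] [cite: CreutzMiller2012, Thm. 1.1] -/
theorem printFamily11A1_krizLi_witness1253 (hKL : KrizLi2019.thm112_bsdTwo_twist) (h33 : KrizLi2019.thm33_rank_twist)
    (htab : KrizLi2019.table2_row11a1) (hS31 : bsdTriple_of_analyticRank_le_one_of_conductor_lt) (hmod : exists_isNewformOf)
    (K : Type) [Field K] [NumberField K] (hK : IsImaginaryQuadratic K) (hdK : NumberField.discr K = -7)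
    (W₂ : WeierstrassCurve ℚ) [W₂.IsElliptic] [W₂.IsGloballyMinimal]
    (hW₂ : ∃ C : VariableChange ℚ, C • curve11A1.quadraticTwist ((1253 : ℤ) : ℚ) = W₂) :
    W₂.analyticRank = 1 ∧ ¬ W₂.HasCM ∧ BSDp W₂ 2 :=
  printFamily11A1_krizLi_rankOneCompanions hKL h33 htab hS31 hmod K hK hdK (inN_neg179_11A1 hK.1 hdK) sign_neg179_11A1 W₂
    (by rw [show ((-7 * (-179) : ℤ) : ℚ) = ((1253 : ℤ) : ℚ) by norm_num]; exact hW₂)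

/-! ### `ℓ = 191`: `#Ẽ(𝔽_191) = 175`, `a_191 = 17` odd; the signed prime `-191 ∈ 𝒩(11a1, ℚ(√−7))` -/

/-- **`#Ẽ(𝔽_191) = 175` for `11a1`** (certified count), so `a_191 = 17`. [cite: KrizLi2019, §6 Example 6.4 (the signed prime -191 of 𝒩)] [cite: SilvermanAEC2009, V.2] -/
theorem reductionPointCount_191_11A1 :
    haveI := isGloballyMinimal_curve11A1
    curve11A1.reductionPointCount 191 = 175 := by
  haveI : Fact (Nat.Prime 191) := ⟨by norm_num⟩
  haveI := isGloballyMinimal_curve11A1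
  exact Supersingular.reductionPointCount_eq_of_intModel_countPoints intModel_11A1 191 (by norm_num) (by decide +kernel)
    (by decide +kernel)

/-- **`a_191(11a1) = 17` is odd** (`Frob_191` of order `3` on `E[2]`). [cite: KrizLi2019, Def. 4.1 and §6 Example 6.4] -/
theorem odd_frobeniusTrace_191_11A1 :
    haveI := isGloballyMinimal_curve11A1
    Odd (curve11A1.frobeniusTrace 191) := by
  haveI := isGloballyMinimal_curve11A1
  rw [Uniform.U2.odd_frobeniusTrace_iff_odd_reductionPointCount _ (by norm_num : Nat.Prime 191) (by norm_num),
    reductionPointCount_191_11A1]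
  decide

/-- **`-191 ∈ 𝒩(11a1, K)`** (`d_K = −7`), as printed in Kriz–Li's Example 6.4: `-191 ≡ 1 (mod 4)`, `|-191| = 191` prime `∉ {2, 11}`, `(−7/191) = 1`, `a_191` odd.
[cite: KrizLi2019, §6 Example 6.4 ("𝒩 consists of square-free products of the signed primes −23, 37, −67, −71, 113, 137, −179, −191, …")] -/
theorem inN_neg191_11A1 {K : Type} [Field K] [NumberField K] (h2 : Module.finrank ℚ K = 2) (hdK : NumberField.discr K = -7) :
    haveI := isGloballyMinimal_curve11A1
    KrizLi2019.InN curve11A1 K (-191) := by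
  haveI := isGloballyMinimal_curve11A1
  have hw : Nat.Prime 191 := by norm_num
  have hna : (-191 : ℤ).natAbs = 191 := rfl
  refine ⟨by decide, by rw [hna]; exact hw.squarefree, fun ℓ hℓ hℓd => ?_⟩
  rw [hna] at hℓd
  obtain rfl := (Nat.prime_dvd_prime_iff_eq hℓ hw).mp hℓd
  exact inS_11A1 h2 hdK hw (by norm_num) (by norm_num) (by norm_num) odd_frobeniusTrace_191_11A1

/-- **`χ_{-191}(−11) = 1`** (automatic here: `Δ(11a1) < 0`, Kriz–Li Cor. to Thm 4.3), read with `N = 11` exact. [cite: KrizLi2019, Thm. 5.1 (2) and §6 Example 6.4 (2)] -/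
theorem sign_neg191_11A1 :
    Int.sign (-191) * jacobiSym (curve11A1.conductorNorm ℤ) (-191 : ℤ).natAbs = 1 := by
  rw [Curve11a.conductorNorm_curve11A1, show (-191 : ℤ).natAbs = 191 from rfl]; norm_num

/-- **The rank-one member `11a1^{(1337)}`** (`1337 = (−7)·(-191)`, `N = 539·191² = 19663259`): `r_an = 1 ∧ ¬CM ∧ BSD(·, 2)` at every global minimal model, from PRINT +
MODULARITY alone — a U₂-class curve of Kriz–Li's printed packet. BSD is not proved by any of this. [cite: KrizLi2019, §6 Example 6.4 (4) and Thm. 5.1 (2)] [cite: CreutzMiller2012, Thm. 1.1] -/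
theorem printFamily11A1_krizLi_witness1337 (hKL : KrizLi2019.thm112_bsdTwo_twist) (h33 : KrizLi2019.thm33_rank_twist)
    (htab : KrizLi2019.table2_row11a1) (hS31 : bsdTriple_of_analyticRank_le_one_of_conductor_lt) (hmod : exists_isNewformOf)
    (K : Type) [Field K] [NumberField K] (hK : IsImaginaryQuadratic K) (hdK : NumberField.discr K = -7)
    (W₂ : WeierstrassCurve ℚ) [W₂.IsElliptic] [W₂.IsGloballyMinimal]
    (hW₂ : ∃ C : VariableChange ℚ, C • curve11A1.quadraticTwist ((1337 : ℤ) : ℚ) = W₂) :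
    W₂.analyticRank = 1 ∧ ¬ W₂.HasCM ∧ BSDp W₂ 2 :=
  printFamily11A1_krizLi_rankOneCompanions hKL h33 htab hS31 hmod K hK hdK (inN_neg191_11A1 hK.1 hdK) sign_neg191_11A1 W₂
    (by rw [show ((-7 * (-191) : ℤ) : ℚ) = ((1337 : ℤ) : ℚ) by norm_num]; exact hW₂)

end Summit.BirchSwinnertonDyer.BirchSwinnertonDyer.Theorems.GenusExact.TwinSwap.KrizLiAnchor11a1

end
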